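import Summits.QuantumFields.YangMills.Theorems.UnitScaleTiltProp7CentreHarmonicRegaugeSupCov
import Summits.QuantumFields.YangMills.Theorems.UnitScaleTiltProp7CentreHarmonicRegaugeSup
import Summits.QuantumFields.YangMills.Theorems.BalabanUVNodesN12RootedForestGeodesic
import Literature.MathematicalPhysics.QuantumFieldTheory.Balaban1983to89.B3ConstantField433
import Literature.MathematicalPhysics.QuantumFieldTheory.Balaban1983to89.B9TorusCalculus
import HarnessLib

/-!
# Route `UnitScaleTilt`, crux K1 «MinimiserStabilityRegPr» (stmt-QuantumFields-19200), route-R E′ path (α′), (E1-b) — THE ZEROTH-ORDER INTERPOLATION ROW (hK₀) IS NOT AN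
# ANALYTIC ROW: for a gauge function PINNED on the k-centres, `sup‖ψ‖ ≤ (d∕2)·L^k·sup‖D_Uψ‖` (covariant, any background with `‖U‖, ‖U⁻¹‖ ≤ 1`; flat twin with `|c|⁻¹·sup‖∂_cψ‖`),
# so P-cov1's displayed `hInterp₀` follows from `hInterp` with `c₀ := d·c_I∕2`

Cell `ym3-torus`, D-0154 (3c) twin-width seat `ym-routeR-w3` (gen 6), successor of the (hK)∕(A)∕(E1-b) lineage (★routeR-w3 g5 HANDOFF §5; LOCATE-E1 §3 (L) row 1 «hInterp₀
(`sup|LinCorr A| ≤ c₀ℓ²·sup|D*_WA|`) — the (hK) kernel family's zeroth-order sibling»).  THE POINT: no kernel is needed for row 1.  `ψ = LinCorr(A)` VANISHES on `C = range (embIter k)`;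
every fine site lies within `tdist ≤ d·(L^k − 1)∕2` of the centre of its own k-block (✓ `N12RootedForestGeodesic.tdist_embIter_iterBlockOf_le`); and one lattice step changes `‖ψ‖`
by at most `‖D_Uψ‖`, because the adjoint transport `R(U)` is an ISOMETRY when `‖U‖, ‖U⁻¹‖ ≤ 1` (`‖X‖ = ‖R(U⁻¹)(R(U)X)‖ ≤ ‖R(U)X‖ ≤ ‖X‖`).  Hence the lattice mean-value bound
✓ `B3ConstantField433.norm_sub_le_tdist` applied to the REAL site function `x ↦ ‖ψ x‖` gives `‖ψ x‖ ≤ tdist(x, centre)·sup‖D_Uψ‖`.  THEOREMS ONLY (0 `def`, 0 `sorry`);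
`--supports stmt-QuantumFields-19200`, count-neutral.  YM₃ on T³ is a ladder rung (R3), not the Clay problem; nothing here claims the stub, the crux, d = 4 or the gap.

WHAT IS PROVED (ns `…Theorems.Prop7PinnedSupOfGradient`).
* §1 (abstract carrier of ✓ `B9Eq39Adjoint`: normed ring `𝔸`, sites `S`, shifts `T`, background `U` with `‖U‖, ‖U⁻¹‖ ≤ 1`) `norm_R_eq` (`‖R(U)X‖ = ‖X‖`),
  ★ `abs_norm_shift_sub_norm_le` (`|‖f(T_μx)‖ − ‖f(x)‖| ≤ ‖(D_Uf)(x,μ)‖`).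
* §2 (torus `Site P j`, `T := torusT P j`) ★★ `norm_sub_norm_le_tdist_mul` (`‖f x‖ − ‖f y‖ ≤ tdist(y,x)·sup‖D_Uf‖`); flat twin `norm_sub_le_tdist_mul_grad`
  (`‖f x − f y‖ ≤ tdist(y,x)·|c|⁻¹·sup_b‖∂_cf(b)‖`, any real normed `V`, `c ≠ 0`).
* §3 (finest torus, `k ≤ m + K`, `ψ` vanishing at every centre `embIter k y`) ★★★ `norm_le_of_vanish_centres` (`‖ψ x‖ ≤ (d∕2)·L^k·sup‖D_Uψ‖`) and the flat
  ★★★ `norm_le_of_vanish_centres_grad` (`‖ψ x‖ ≤ (d∕2)·L^k·|c|⁻¹·sup‖∂_cψ‖`).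
* §4 THE DISPLAYED ROW REMOVED: ★★ `hInterp₀_of_hInterp` — in the exact currency of ✓ `Prop7CentreHarmonicRegaugeSupCov.sup_regaugeCov_le_of_rows` at `S := Site P 0`, `T := torusT P 0`,
  `C := range (embIter k)`, `ℓ := L^k`: `hH ∧ hInterp ⇒ hInterp₀` with `c₀ := d·c_I∕2`; ★★★ `sup_regaugeCov_le_of_rows_pinned` = P-cov1's four conclusions WITHOUT `hInterp₀`
  (curl defect `≤ 2w·(d·c_I∕2)·s₁′`); flat ★★ `hInterp₀_flat_of_hInterp` (`‖(φ − φ_H)(y)‖ ≤ (d·c_I∕(2|c|))·ℓ²·(s₁′(ℓ²)⁻¹)`).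
HONEST SCOPE.  Bookkeeping over three tree letters; the first-order row `hInterp` = (hK) stays displayed here (flat: ✓p669951 `Prop7PinnedKernelL1.exists_green_kernel_l1_le` ∘ ✓p654411;
covariant: P-cov2, routeR-w6 lineage); (hK₂ := ρ₃) is px7 g3's (hK₂-W) chain.  So (E1-b) = (hK) + (hK₂) only.  Constants ours; nothing of print beyond the cited tree letters is asserted.

References: T. Bałaban, CMP 99 (1985) 75–102 [Balaban1985RegularSpaces] ((1.14) p.78, (1.36) p.82); CMP 99 (1985) 389–434 [Balaban1985BackgroundPropagators] ((3.1)–(3.8) pp.390–392);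
T. Bałaban, CMP 86 (1982) 555–594 ∕ (Higgs)₃ CMP 88 (1983) 411–445 [Balaban1983Higgs3] (p.433, lattice mean-value bound); CMP 109 (1987) 249–301 [Balaban1987RG1] ((0.1)–(0.3) pp.251–252).
-/

set_option autoImplicit false

noncomputable section

open scoped BigOperators

namespace Summit.QuantumFields.YangMills.Theorems.Prop7PinnedSupOfGradient

open Literature.MathematicalPhysics.QuantumFieldTheory.Balaban1983to89
open LatticeFieldCalculus
open B9Eq39Adjoint (R R_inv_R covD curl divB plaqU)
open B9Eq310Hermitian (norm_R_le)
open B9TorusCalculus (torusT torusT_apply torusT_comm)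
open B15DeterminingSets (embIter)
open B5Eq118OneStroke (iterBlockOf)
open B3ConstantField433 (norm_sub_le_tdist)
open Summit.QuantumFields.YangMills.BalabanUVNodes.N12RootedForestGeodesic (tdist_embIter_iterBlockOf_le)
open Summit.QuantumFields.YangMills.Theorems.Prop7CentreHarmonicRegaugeSupCov (sup_regaugeCov_le_of_rows)

/-! ## §1 One lattice step changes `‖ψ‖` by at most `‖D_Uψ‖` -/

section Abstract

variable {𝔸 : Type*} [NormedRing 𝔸] {S : Type*} {ι : Type*} (T : ι → Equiv.Perm S) (U : ι → S → 𝔸ˣ)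

omit T in
/-- **The adjoint transport is an isometry** when `‖U‖, ‖U⁻¹‖ ≤ 1`: `‖R(U)X‖ = ‖X‖` (`≤` is ✓ `norm_R_le`; `≥` from `X = R(U⁻¹)(R(U)X)`).
[cite: Balaban1985BackgroundPropagators, (3.1) p.390] -/
theorem norm_R_eq {W : 𝔸ˣ} (h₁ : ‖(W : 𝔸)‖ ≤ 1) (h₂ : ‖((W⁻¹ : 𝔸ˣ) : 𝔸)‖ ≤ 1) (X : 𝔸) : ‖R W X‖ = ‖X‖ := by
  refine le_antisymm (norm_R_le h₁ h₂ X) ?_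
  have h₂' : ‖(((W⁻¹)⁻¹ : 𝔸ˣ) : 𝔸)‖ ≤ 1 := by rw [inv_inv]; exact h₁
  calc ‖X‖ = ‖R W⁻¹ (R W X)‖ := by rw [R_inv_R]
    _ ≤ ‖R W X‖ := norm_R_le h₂ h₂' _

/-- ★ **ONE STEP COSTS AT MOST `‖D_Uψ‖`**: `|‖f(T_μx)‖ − ‖f(x)‖| ≤ ‖(D_Uf)(x,μ)‖` (`D_Uf(x,μ) = R(U(x,μ))f(T_μx) − f(x)` and `R(U)` is an isometry).
[cite: Balaban1985BackgroundPropagators, (3.8) p.392] -/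
theorem abs_norm_shift_sub_norm_le (hU : ∀ (κ : ι) (y : S), ‖(U κ y : 𝔸)‖ ≤ 1 ∧ ‖(((U κ y)⁻¹ : 𝔸ˣ) : 𝔸)‖ ≤ 1) (f : S → 𝔸) (μ : ι) (x : S) :
    |‖f (T μ x)‖ - ‖f x‖| ≤ ‖covD T U μ f x‖ := by
  have hR : ‖R (U μ x) (f (T μ x))‖ = ‖f (T μ x)‖ := norm_R_eq (hU μ x).1 (hU μ x).2 _
  have e : covD T U μ f x = R (U μ x) (f (T μ x)) - f x := rfl
  rw [abs_sub_le_iff]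
  constructor
  · -- `‖f(Tx)‖ = ‖R f(Tx)‖ = ‖D f + f x‖ ≤ ‖D f‖ + ‖f x‖`
    have h1 : ‖R (U μ x) (f (T μ x))‖ ≤ ‖covD T U μ f x‖ + ‖f x‖ := by
      rw [e]; exact norm_le_norm_sub_add _ _
    linarith
  · -- `‖f x‖ = ‖R f(Tx) − D f‖ ≤ ‖f(Tx)‖ + ‖D f‖`
    have h1 : ‖f x‖ ≤ ‖R (U μ x) (f (T μ x))‖ + ‖covD T U μ f x‖ := by
      have e2 : f x = R (U μ x) (f (T μ x)) - covD T U μ f x := by rw [e]; abel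
      calc ‖f x‖ = ‖R (U μ x) (f (T μ x)) - covD T U μ f x‖ := by rw [← e2]
        _ ≤ ‖R (U μ x) (f (T μ x))‖ + ‖covD T U μ f x‖ := norm_sub_le _ _
    linarith

end Abstract

/-! ## §2 On the torus: the mean-value bound for `x ↦ ‖f x‖` -/

section Torus

variable {P : Params} {j : ℕ}

/-- ★★ **`‖f x‖ − ‖f y‖ ≤ |x − y|₁·sup‖D_Uf‖`** on `T^{(j)}` (`T := torusT`, background with `‖U‖, ‖U⁻¹‖ ≤ 1`): ✓ `B3ConstantField433.norm_sub_le_tdist` for the REAL site function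
`x ↦ ‖f x‖`, whose forward differences are bounded by §1. [cite: Balaban1983Higgs3, p.433; Balaban1985BackgroundPropagators, (3.8) p.392] -/
theorem norm_sub_norm_le_tdist_mul {𝔸 : Type*} [NormedRing 𝔸] (U : Fin P.d → Site P j → 𝔸ˣ)
    (hU : ∀ (κ : Fin P.d) (y : Site P j), ‖(U κ y : 𝔸)‖ ≤ 1 ∧ ‖(((U κ y)⁻¹ : 𝔸ˣ) : 𝔸)‖ ≤ 1)
    (f : Site P j → 𝔸) {a : ℝ} (ha : ∀ (μ : Fin P.d) (x : Site P j), ‖covD (torusT P j) U μ f x‖ ≤ a) (y x : Site P j) :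
    ‖f x‖ - ‖f y‖ ≤ (Site.tdist y x : ℝ) * a := by
  have h := norm_sub_le_tdist (P := P) (j := j) (V := ℝ) (η := 1) one_pos (fun z => ‖f z‖) (Pb := a) (fun z μ => by
    rw [inv_one, pdiff, one_smul, Real.norm_eq_abs]
    have h1 := abs_norm_shift_sub_norm_le (torusT P j) U hU f μ z
    rw [torusT_apply] at h1
    exact h1.trans (ha μ z)) y x
  rw [one_mul, Real.norm_eq_abs] at h
  exact (le_abs_self _).trans h

/-- **Flat twin, for the difference itself**: `‖f x − f y‖ ≤ |x − y|₁·|c|⁻¹·sup_b‖(∂_cf)(b)‖` (`c ≠ 0`, any real normed `V`). [cite: Balaban1983Higgs3, p.433; Balaban1984PropagatorsI, (1.4) p.18] -/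
theorem norm_sub_le_tdist_mul_grad {V : Type*} [NormedAddCommGroup V] [NormedSpace ℝ V] {c : ℝ} (hc : c ≠ 0)
    (f : SiteField P j V) {a : ℝ} (ha : ∀ b : PBond P j, ‖grad c f b‖ ≤ a) (y x : Site P j) :
    ‖f x - f y‖ ≤ (Site.tdist y x : ℝ) * (|c|⁻¹ * a) := by
  have hca : 0 < |c| := abs_pos.mpr hc
  have h := norm_sub_le_tdist (P := P) (j := j) (V := V) (η := 1) one_pos f (Pb := |c|⁻¹ * a) (fun z μ => by
    rw [inv_one, pdiff, one_smul]
    have h1 := ha ⟨z, μ⟩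
    rw [grad, norm_smul, Real.norm_eq_abs] at h1
    rw [le_inv_mul_iff₀ hca]
    exact h1) y x
  rw [one_mul] at h
  exact h

end Torus

/-! ## §3 Pinned on the k-centres: `sup‖ψ‖ ≤ (d∕2)·L^k·sup‖D_Uψ‖` -/

section Pinned

variable {P : Params}

/-- the half-block radius as a real number: `d·((L^k − 1)∕2) ≤ (d∕2)·L^k`. [folklore] -/
theorem cast_half_block_le (k : ℕ) : ((P.d * ((P.L ^ k - 1) / 2) : ℕ) : ℝ) ≤ (P.d : ℝ) / 2 * (P.L : ℝ) ^ k := by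
  have h1 : (((P.L ^ k - 1) / 2 : ℕ) : ℝ) ≤ ((P.L : ℝ) ^ k) / 2 := by
    have h2 : 2 * ((P.L ^ k - 1) / 2) ≤ P.L ^ k := by omega
    have h3 : (2 : ℝ) * (((P.L ^ k - 1) / 2 : ℕ) : ℝ) ≤ (P.L : ℝ) ^ k := by exact_mod_cast h2
    linarith
  rw [Nat.cast_mul]
  calc (P.d : ℝ) * (((P.L ^ k - 1) / 2 : ℕ) : ℝ) ≤ (P.d : ℝ) * (((P.L : ℝ) ^ k) / 2) := mul_le_mul_of_nonneg_left h1 (Nat.cast_nonneg _)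
    _ = (P.d : ℝ) / 2 * (P.L : ℝ) ^ k := by ring

/-- ★★★ **A PINNED GAUGE FUNCTION IS BOUNDED BY ITS COVARIANT GRADIENT**: on the finest torus, if `ψ` vanishes at every k-centre `embIter k y` (`k ≤ m + K`) and `‖D_Uψ‖ ≤ a` everywhere
(background with `‖U‖, ‖U⁻¹‖ ≤ 1`), then `‖ψ x‖ ≤ (d∕2)·L^k·a` at every site — (hK₀) ⟸ (hK). [cite: Balaban1985RegularSpaces, (1.14) p.78, (1.36) p.82] -/
theorem norm_le_of_vanish_centres {𝔸 : Type*} [NormedRing 𝔸] {k : ℕ} (hk : k ≤ P.m + P.K) (U : Fin P.d → Site P 0 → 𝔸ˣ)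
    (hU : ∀ (κ : Fin P.d) (y : Site P 0), ‖(U κ y : 𝔸)‖ ≤ 1 ∧ ‖(((U κ y)⁻¹ : 𝔸ˣ) : 𝔸)‖ ≤ 1)
    (ψ : Site P 0 → 𝔸) (h0 : ∀ y : Site P k, ψ (embIter k y) = 0)
    {a : ℝ} (ha : ∀ (μ : Fin P.d) (x : Site P 0), ‖covD (torusT P 0) U μ ψ x‖ ≤ a) (x : Site P 0) :
    ‖ψ x‖ ≤ (P.d : ℝ) / 2 * (P.L : ℝ) ^ k * a := by
  have ha0 : 0 ≤ a := (norm_nonneg _).trans (ha ⟨0, P.hd⟩ x)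
  have h1 := norm_sub_norm_le_tdist_mul U hU ψ ha (embIter k (iterBlockOf k x)) x
  rw [h0, norm_zero, sub_zero] at h1
  have h2 : (Site.tdist (embIter k (iterBlockOf k x)) x : ℝ) ≤ (P.d : ℝ) / 2 * (P.L : ℝ) ^ k := by
    have h3 := tdist_embIter_iterBlockOf_le hk x
    rw [B3Taylor310LocalRemainder.tdist_comm] at h3
    exact (by exact_mod_cast h3 : (Site.tdist (embIter k (iterBlockOf k x)) x : ℝ) ≤ ((P.d * ((P.L ^ k - 1) / 2) : ℕ) : ℝ)).trans
      (cast_half_block_le k)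
  exact h1.trans (mul_le_mul_of_nonneg_right h2 ha0)

/-- ★★★ **FLAT TWIN**: `ψ` vanishing at every k-centre, `‖∂_cψ(b)‖ ≤ a` (`c ≠ 0`) ⇒ `‖ψ x‖ ≤ (d∕2)·L^k·|c|⁻¹·a`. [cite: Balaban1985RegularSpaces, (1.14) p.78, (1.36) p.82] -/
theorem norm_le_of_vanish_centres_grad {V : Type*} [NormedAddCommGroup V] [NormedSpace ℝ V] {k : ℕ} (hk : k ≤ P.m + P.K) {c : ℝ} (hc : c ≠ 0)
    (ψ : SiteField P 0 V) (h0 : ∀ y : Site P k, ψ (embIter k y) = 0)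
    {a : ℝ} (ha : ∀ b : PBond P 0, ‖grad c ψ b‖ ≤ a) (x : Site P 0) :
    ‖ψ x‖ ≤ (P.d : ℝ) / 2 * (P.L : ℝ) ^ k * (|c|⁻¹ * a) := by
  have ha0 : 0 ≤ |c|⁻¹ * a := mul_nonneg (inv_nonneg.mpr (abs_nonneg c)) ((norm_nonneg _).trans (ha ⟨x, ⟨0, P.hd⟩⟩))
  have h1 := norm_sub_le_tdist_mul_grad hc ψ ha (embIter k (iterBlockOf k x)) x
  rw [h0, sub_zero] at h1
  have h2 : (Site.tdist (embIter k (iterBlockOf k x)) x : ℝ) ≤ (P.d : ℝ) / 2 * (P.L : ℝ) ^ k := by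
    have h3 := tdist_embIter_iterBlockOf_le hk x
    rw [B3Taylor310LocalRemainder.tdist_comm] at h3
    exact (by exact_mod_cast h3 : (Site.tdist (embIter k (iterBlockOf k x)) x : ℝ) ≤ ((P.d * ((P.L ^ k - 1) / 2) : ℕ) : ℝ)).trans
      (cast_half_block_le k)
  exact h1.trans (mul_le_mul_of_nonneg_right h2 ha0)

end Pinned

/-! ## §4 P-cov1 without `hInterp₀` -/

section Rows

variable {P : Params} {𝔸 : Type*} [NormedRing 𝔸]

/-- ★★ **`hInterp₀` FROM `hInterp`** (currency of ✓ `sup_regaugeCov_le_of_rows` at `S := Site P 0`, `T := torusT P 0`, `C := range (embIter k)`, `ℓ := L^k`): the pinned gauge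
function `φ − φ_H` satisfies `‖(φ − φ_H)(y)‖ ≤ (d·c_I∕2)·ℓ²·(s₁′(ℓ²)⁻¹)`. [cite: Balaban1985RegularSpaces, (1.36) p.82, (1.14) p.78] -/
theorem hInterp₀_of_hInterp {k : ℕ} (hk : k ≤ P.m + P.K) (U : Fin P.d → Site P 0 → 𝔸ˣ)
    (hU : ∀ (κ : Fin P.d) (y : Site P 0), ‖(U κ y : 𝔸)‖ ≤ 1 ∧ ‖(((U κ y)⁻¹ : 𝔸ˣ) : 𝔸)‖ ≤ 1)
    (φ φH : Site P 0 → 𝔸) (hH : ∀ y ∈ Set.range (embIter (P := P) k), φH y = φ y) {s₁' cI : ℝ}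
    (hInterp : ∀ (μ : Fin P.d) (x : Site P 0), ‖covD (torusT P 0) U μ (fun y => φ y - φH y) x‖ ≤ cI * (P.L : ℝ) ^ k * (s₁' * (((P.L : ℝ) ^ k) ^ 2)⁻¹)) :
    ∀ y : Site P 0, ‖φ y - φH y‖ ≤ (P.d * cI / 2) * ((P.L : ℝ) ^ k) ^ 2 * (s₁' * (((P.L : ℝ) ^ k) ^ 2)⁻¹) := by
  intro y
  have h0 : ∀ z : Site P k, (fun y => φ y - φH y) (embIter k z) = 0 := fun z => by
    simp only [hH (embIter k z) ⟨z, rfl⟩, sub_self]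
  have h := norm_le_of_vanish_centres hk U hU (fun y => φ y - φH y) h0 hInterp y
  have e : (P.d : ℝ) / 2 * (P.L : ℝ) ^ k * (cI * (P.L : ℝ) ^ k * (s₁' * (((P.L : ℝ) ^ k) ^ 2)⁻¹))
      = (P.d * cI / 2) * ((P.L : ℝ) ^ k) ^ 2 * (s₁' * (((P.L : ℝ) ^ k) ^ 2)⁻¹) := by ring
  rw [← e]
  exact h

/-- ★★★ **LEMMA (S_H-SUP′), COVARIANT, ON THE FINEST TORUS, WITHOUT `hInterp₀`**: P-cov1's ✓ `sup_regaugeCov_le_of_rows` at `T := torusT P 0`, `C := range (embIter k)` (`k ≤ m + K`), `ℓ := L^k`,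
the zeroth-order row supplied by `hInterp₀_of_hInterp` (`c₀ := d·c_I∕2`): (i) `‖A_H(x,μ)‖ ≤ (s₀ + c_I s₁′)ℓ⁻¹`, (ii) `‖curl A_H(p) − curl A(p)‖ ≤ 2w·((d·c_I∕2)·s₁′)`,
(iii) `Δ_U(D^*_UA_H) = 0` off the centres, (iv) `(φ − φ_H)` vanishes at the centres. [cite: Balaban1985RegularSpaces, (1.36) p.82, (1.14) p.78; Balaban1985BackgroundPropagators, (3.1)-(3.8) pp.390-392] -/
theorem sup_regaugeCov_le_of_rows_pinned {k : ℕ} (hk : k ≤ P.m + P.K) (U : Fin P.d → Site P 0 → 𝔸ˣ)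
    (hU : ∀ (κ : Fin P.d) (y : Site P 0), ‖(U κ y : 𝔸)‖ ≤ 1 ∧ ‖(((U κ y)⁻¹ : 𝔸ˣ) : 𝔸)‖ ≤ 1)
    (A : Fin P.d → Site P 0 → 𝔸) (φ φH : Site P 0 → 𝔸) {s₀ s₁' cI w : ℝ}
    (hplaq : ∀ (μ ν : Fin P.d) (x : Site P 0), ‖(plaqU (torusT P 0) U μ ν x : 𝔸) - 1‖ ≤ w)
    (hA : ∀ (μ : Fin P.d) (x : Site P 0), ‖A μ x‖ ≤ s₀ * ((P.L : ℝ) ^ k)⁻¹)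
    (hφ : ∀ x, divB (torusT P 0) U (fun μ z => covD (torusT P 0) U μ φ z) x = divB (torusT P 0) U A x)
    (hH : ∀ y ∈ Set.range (embIter (P := P) k), φH y = φ y)
    (hEL : ∀ x ∉ Set.range (embIter (P := P) k),
      divB (torusT P 0) U (fun μ z => covD (torusT P 0) U μ (fun y => divB (torusT P 0) U (fun ν w' => covD (torusT P 0) U ν φH w') y) z) x = 0)
    (hInterp : ∀ (μ : Fin P.d) (x : Site P 0), ‖covD (torusT P 0) U μ (fun y => φ y - φH y) x‖ ≤ cI * (P.L : ℝ) ^ k * (s₁' * (((P.L : ℝ) ^ k) ^ 2)⁻¹)) :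
    (∀ (μ : Fin P.d) (x : Site P 0), ‖A μ x - covD (torusT P 0) U μ (fun y => φ y - φH y) x‖ ≤ (s₀ + cI * s₁') * ((P.L : ℝ) ^ k)⁻¹)
      ∧ (∀ (μ ν : Fin P.d) (x : Site P 0),
          ‖curl (torusT P 0) U (fun κ z => A κ z - covD (torusT P 0) U κ (fun y => φ y - φH y) z) μ ν x - curl (torusT P 0) U A μ ν x‖ ≤ 2 * w * ((P.d * cI / 2) * s₁'))
      ∧ (∀ x ∉ Set.range (embIter (P := P) k),
          divB (torusT P 0) U (fun μ z => covD (torusT P 0) U μ (fun y => divB (torusT P 0) U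
            (fun ν w' => A ν w' - covD (torusT P 0) U ν (fun y' => φ y' - φH y') w') y) z) x = 0)
      ∧ (∀ y ∈ Set.range (embIter (P := P) k), (fun y => φ y - φH y) y = 0) := by
  have hℓ : (0 : ℝ) < (P.L : ℝ) ^ k := pow_pos (by exact_mod_cast P.L_pos) k
  exact sup_regaugeCov_le_of_rows (torusT P 0) U hU (fun μ ν x => torusT_comm ν μ x) (Set.range (embIter (P := P) k)) A φ φH hℓ hplaq hA hφ hH hEL hInterp
    (hInterp₀_of_hInterp hk U hU φ φH hH hInterp)

/-- ★★ **FLAT: `hInterp₀` FROM `hInterp`** (currency of ✓ `Prop7CentreHarmonicRegaugeSup.sup_regauge_le_of_rows` on `Site P 0`, `C := range (embIter k)`, `ℓ := L^k`, `c ≠ 0`):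
`‖(φ − φ_H)(y)‖ ≤ (d·c_I∕(2|c|))·ℓ²·(s₁′(ℓ²)⁻¹)`. [cite: Balaban1985RegularSpaces, (1.36) p.82, (1.14) p.78; Balaban1984PropagatorsI, (1.4) p.18] -/
theorem hInterp₀_flat_of_hInterp {V : Type*} [NormedAddCommGroup V] [NormedSpace ℝ V] {k : ℕ} (hk : k ≤ P.m + P.K) {c : ℝ} (hc : c ≠ 0)
    (φ φH : SiteField P 0 V) (hH : ∀ y ∈ Set.range (embIter (P := P) k), φH y = φ y) {s₁' cI : ℝ}
    (hInterp : ∀ b : PBond P 0, ‖grad c (fun x => φ x - φH x) b‖ ≤ cI * (P.L : ℝ) ^ k * (s₁' * (((P.L : ℝ) ^ k) ^ 2)⁻¹)) :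
    ∀ y : Site P 0, ‖φ y - φH y‖ ≤ (P.d * cI / (2 * |c|)) * ((P.L : ℝ) ^ k) ^ 2 * (s₁' * (((P.L : ℝ) ^ k) ^ 2)⁻¹) := by
  intro y
  have hca : |c| ≠ 0 := abs_ne_zero.mpr hc
  have h0 : ∀ z : Site P k, (fun y => φ y - φH y) (embIter k z) = 0 := fun z => by
    simp only [hH (embIter k z) ⟨z, rfl⟩, sub_self]
  have h := norm_le_of_vanish_centres_grad hk hc (fun y => φ y - φH y) h0 hInterp y
  have e : (P.d : ℝ) / 2 * (P.L : ℝ) ^ k * (|c|⁻¹ * (cI * (P.L : ℝ) ^ k * (s₁' * (((P.L : ℝ) ^ k) ^ 2)⁻¹)))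
      = (P.d * cI / (2 * |c|)) * ((P.L : ℝ) ^ k) ^ 2 * (s₁' * (((P.L : ℝ) ^ k) ^ 2)⁻¹) := by
    field_simp
  rw [← e]
  exact h

end Rows

end Summit.QuantumFields.YangMills.Theorems.Prop7PinnedSupOfGradient

end
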